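import Summits.BirchSwinnertonDyer.BirchSwinnertonDyer.Theorems.UniversalToricDescentThinCombRigidity
import HarnessLib

/-!
# Thin-comb rigidity (crux idea `thin-comb-reflection` on the WALL `AdditiveSplitIMCInclusionAtThree`, item
# stmt-BirchSwinnertonDyer-20395) — Part VI: visibility of primes in `(p, T₂) ∩ (p, S)` (helper,
# `--supports stmt-BirchSwinnertonDyer-20395`; cell `pub/bsd-wall`, lead `cruxlead-20395` g2)

WHY (Parts VI–VII). Part IV proves rigidity for a reflection `ρ` with `(1+T₂)(1+ρT₁) = 1` (so `ρ` maps `(p, T₁)`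
onto `(p, T₂)`). Arithmetically `ρ = c∘ι` in a `ℤ_p`-basis `(γ₁, γ₂)` of `Gal(K̃_∞/K)` with `γ₂` spanning the
saturated inertia line of `𝔭′` — the basis in which the thin comb IS vertical — and `ρ(γ₂) = (cγ₂c)⁻¹` spans the
inertia line of `𝔭`. These two lines span `Gal(K̃_∞/K) ≅ ℤ_p²` only up to a finite index, which is `1` iff the first
layer of the anticyclotomic `ℤ_p`-extension of `K` is ramified; it is unramified e.g. for `K = ℚ(√−23)`, `p = 3`
(`h_K = 3`, `3` split, `K_∞^{ac} ⊇` Hilbert class field), and then NO basis makes `c∘ι` an `IsReflection` while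
keeping the comb vertical (line `thin_comb`'s `stub_frame` is mis-stated in that case). Parts VI–VII remove the
issue: rigidity holds for EVERY constant-fixing automorphism `ρ` that merely FAILS TO STABILISE the ideal `(p, T₂)`,
i.e. `ρ(T₂) ∉ (p, T₂)` — which `c∘ι` satisfies in every vertical basis (`cγ₂c ∉ \overline{⟨γ₂⟩}`).

THIS FILE (§8): `exists_level_not_shape_of_mem_span_pair` — for any non-unit `S ∉ (p, T₂)` of `Λ₂(𝒪)`, a prime-like
`Q ∈ (p, T₂) ∩ (p, S)` with `p ∤ Q` is VISIBLE on all deep comb levels (generalises Part II's case `S = T₁`). Proof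
at level `m`: `Q = p·α + T₂·S·β`, so a shape `Q ≡ ϖ^s·unit` forces, after cancelling one `ϖ`, `S·β ≡ ϖ^{s−1}·unit`,
hence (descent with a unit series) `S ≡ ϖ^t·unit` in `𝒪_m⟦T₁⟧` — contradicting "`S` has a unit coefficient (as
`S ∉ (p, T₂)`) but a non-unit constant term (as `S` is a non-unit)". Also: `𝒪_m` is local with maximal ideal `(ϖ)`.

`𝒪` is a DVR with maximal ideal `(p)`. Theorems only; nothing about elliptic curves; BSD is not proved by any of this.
References: Washington §7.1–7.2, §13.4 [cite: Washington1997, §7.1–§7.2 and §13.4]; Brink, Math. Comp. 76 (2007) §II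
(anticyclotomic tower vs. Hilbert class field) [cite: Brink2007, §II Prop. 1].
-/

set_option linter.dupNamespace false

noncomputable section

namespace Summit.BirchSwinnertonDyer.BirchSwinnertonDyer.Theorems.UniversalToricDescentThinComb

/-! ## §8 Visibility of primes in `(p, T₂) ∩ (p, S)` -/

section WeakVisibility

variable (𝒪 : Type*) [CommRing 𝒪] [IsDomain 𝒪] [IsDiscreteValuationRing 𝒪] (p : ℕ) [hp : Fact p.Prime]

omit [IsDomain 𝒪] [IsDiscreteValuationRing 𝒪] hp in
/-- Descent with a unit SERIES on the right: if `ϖ` is a prime non-zero-divisor of `R` and `P·q = ϖ^v·w` in `R⟦T⟧`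
with `w` a unit, then `P = ϖ^t·u` with `u` a unit. [cite: Washington1997, §7.1] -/
theorem exists_eq_C_pow_mul_unit_of_mul_eq_unit {R : Type*} [CommRing R] {ϖ : R} (hϖ : Prime ϖ)
    (hreg : ∀ z : R, ϖ * z = 0 → z = 0) :
    ∀ (v : ℕ) (P q w : PowerSeries R), IsUnit w →
      P * q = PowerSeries.C (ϖ ^ v) * w → ∃ (t : ℕ) (u : PowerSeries R), IsUnit u ∧ P = PowerSeries.C (ϖ ^ t) * u := by
  have hC : Prime (PowerSeries.C ϖ : PowerSeries R) := Literature.NumberTheory.EllipticCurves.prime_C_of_prime hϖ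
  intro v
  induction v with
  | zero =>
    intro P q w hw h
    rw [pow_zero, map_one, one_mul] at h
    exact ⟨0, P, isUnit_of_mul_isUnit_left (y := q) (h ▸ hw), by simp⟩
  | succ v ih =>
    intro P q w hw h
    have hdvd : (PowerSeries.C ϖ : PowerSeries R) ∣ P * q :=
      ⟨PowerSeries.C (ϖ ^ v) * w, by rw [h, pow_succ, map_mul]; ring⟩
    have e : PowerSeries.C ϖ * (PowerSeries.C (ϖ ^ v) * w) = PowerSeries.C (ϖ ^ (v + 1)) * w := by
      rw [← mul_assoc, ← map_mul, ← pow_succ']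
    rcases hC.dvd_or_dvd hdvd with ⟨P', rfl⟩ | ⟨q', rfl⟩
    · have h' : P' * q = PowerSeries.C (ϖ ^ v) * w := by
        have h2 : PowerSeries.C ϖ * (P' * q - PowerSeries.C (ϖ ^ v) * w) = 0 := by
          rw [mul_sub, e, ← h]; ring
        exact sub_eq_zero.mp (C_mul_eq_zero_imp hreg h2)
      obtain ⟨t, u, hu, rfl⟩ := ih P' q w hw h'
      exact ⟨t + 1, u, hu, by rw [pow_succ, map_mul]; ring⟩
    · have h' : P * q' = PowerSeries.C (ϖ ^ v) * w := by
        have h2 : PowerSeries.C ϖ * (P * q' - PowerSeries.C (ϖ ^ v) * w) = 0 := by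
          rw [mul_sub, e, ← h]; ring
        exact sub_eq_zero.mp (C_mul_eq_zero_imp hreg h2)
      exact ih P q' w hw h'

/-- In the level ring `𝒪_m`: an element is a unit iff it is not in `(ϖ)` (`𝒪_m` is local with maximal ideal `(ϖ)`,
`𝒪_m/(ϖ) = 𝒪/(p)`). [cite: Washington1997, §7.1] -/
theorem levelRing_isUnit_of_not_mem (hmax : IsLocalRing.maximalIdeal 𝒪 = Ideal.span {(p : 𝒪)}) (m : ℕ)
    {x : LevelRing 𝒪 p m}
    (hx : x ∉ Ideal.span {Ideal.Quotient.mk (Ideal.span {combSeries 𝒪 p m}) PowerSeries.X}) : IsUnit x := by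
  obtain ⟨hp0, hpu, hprime, -⟩ := p_ne_zero_of_maximalIdeal_eq 𝒪 p hmax
  haveI := hprime
  haveI : (Ideal.span {(p : 𝒪)}).IsMaximal := by rw [← hmax]; exact IsLocalRing.maximalIdeal.isMaximal 𝒪
  haveI : Nontrivial (LevelRing 𝒪 p m) :=
    Ideal.Quotient.nontrivial_iff.mpr (Ideal.span_singleton_ne_top (combSeries_not_isUnit 𝒪 p m hpu))
  haveI : IsLocalRing (LevelRing 𝒪 p m) :=
    IsLocalRing.of_surjective' (Ideal.Quotient.mk _) Ideal.Quotient.mk_surjective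
  obtain ⟨σ, hσs, -, hker⟩ := exists_levelRing_to_residue 𝒪 p m
  letI := Ideal.Quotient.field (Ideal.span {(p : 𝒪)})
  have hmaxm : (RingHom.ker σ).IsMaximal := RingHom.ker_isMaximal_of_surjective σ hσs
  rw [← hker, IsLocalRing.eq_maximalIdeal hmaxm] at hx
  exact IsLocalRing.notMem_maximalIdeal.mp hx

/-- **Visibility of primes in `(p, T₂) ∩ (p, S)`.** Let `S ∈ Λ₂(𝒪)` be a non-unit with `S ∉ (p, T₂)`. If
`Q ∈ (p, T₂) ∩ (p, S)` and `p ∤ Q`, then on all comb levels `m ≥ m₀(Q)` the reduction of `Q` to `𝒪_m⟦T₁⟧` is NOT of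
the shape `ϖ^s·(unit)`. (Part II's `exists_level_not_shape_of_mem_span_T₁` is the case `S = T₁`.)
[cite: Washington1997, §7.1–§7.2] -/
theorem exists_level_not_shape_of_mem_span_pair (hmax : IsLocalRing.maximalIdeal 𝒪 = Ideal.span {(p : 𝒪)})
    {S Q : PowerSeries (PowerSeries 𝒪)} (hSu : ¬ IsUnit S) (hS : S ∉ Ideal.span {const 𝒪 (p : 𝒪), T₂ 𝒪})
    (hQ2 : Q ∈ Ideal.span {const 𝒪 (p : 𝒪), T₂ 𝒪}) (hQS : Q ∈ Ideal.span {const 𝒪 (p : 𝒪), S})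
    (hQp : ¬ const 𝒪 (p : 𝒪) ∣ Q) :
    ∃ m₀ : ℕ, ∀ m : ℕ, m₀ ≤ m → ¬ ∃ (s : ℕ) (u : PowerSeries (LevelRing 𝒪 p m)), IsUnit u ∧
      PowerSeries.map (Ideal.Quotient.mk (Ideal.span {combSeries 𝒪 p m})) Q =
        PowerSeries.C ((Ideal.Quotient.mk (Ideal.span {combSeries 𝒪 p m}) PowerSeries.X) ^ s) * u := by
  classical
  obtain ⟨hp0, hpu, hprime, hpprime⟩ := p_ne_zero_of_maximalIdeal_eq 𝒪 p hmax
  haveI := hprime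
  haveI : Nontrivial (𝒪 ⧸ Ideal.span {(p : 𝒪)}) := Ideal.Quotient.nontrivial_iff.mpr hprime.ne_top
  -- the reduction modulo `(p, T₂)` to `k⟦T₁⟧`
  set θ : PowerSeries (PowerSeries 𝒪) →+* PowerSeries (𝒪 ⧸ Ideal.span {(p : 𝒪)}) :=
    PowerSeries.map ((Ideal.Quotient.mk (Ideal.span {(p : 𝒪)})).comp PowerSeries.constantCoeff) with hθ
  have hθp : θ (const 𝒪 (p : 𝒪)) = 0 := by
    rw [hθ, const, RingHom.comp_apply, PowerSeries.map_C, RingHom.comp_apply, PowerSeries.constantCoeff_C,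
      Ideal.Quotient.eq_zero_iff_mem.mpr (Ideal.mem_span_singleton_self _), map_zero]
  have hθT : θ (T₂ 𝒪) = 0 := by
    rw [hθ, T₂, PowerSeries.map_C, RingHom.comp_apply, PowerSeries.constantCoeff_X, map_zero, map_zero]
  have hθS : θ S ≠ 0 := fun h => hS (mem_span_const_T₂_of_map_eq_zero 𝒪 p h)
  -- `Q = p·α₁ + T₂·S·β₁`
  obtain ⟨a, b, hab⟩ := Ideal.mem_span_pair.mp hQS
  have hθQ : θ Q = 0 := by
    obtain ⟨a', b', hab'⟩ := Ideal.mem_span_pair.mp hQ2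
    rw [← hab', map_add, map_mul, map_mul, hθp, hθT, mul_zero, mul_zero, add_zero]
  have hθb : θ b = 0 := by
    have : θ b * θ S = 0 := by
      have := congrArg θ hab
      rw [map_add, map_mul, map_mul, hθp, mul_zero, zero_add, hθQ] at this
      exact this
    exact (mul_eq_zero.mp this).resolve_right hθS
  obtain ⟨b₁, b₂, hb⟩ := Ideal.mem_span_pair.mp (mem_span_const_T₂_of_map_eq_zero 𝒪 p hθb)
  have hQeq : Q = const 𝒪 (p : 𝒪) * (a + b₁ * S) + T₂ 𝒪 * (S * b₂) := by
    rw [← hab, ← hb]; ring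
  -- a coefficient of `Q` not divisible by `p`
  have hex : ∃ i, ¬ PowerSeries.C (p : 𝒪) ∣ PowerSeries.coeff i Q := by
    by_contra hall
    push Not at hall
    apply hQp
    choose c hc using hall
    refine ⟨PowerSeries.mk c, ?_⟩
    ext i j
    rw [const, RingHom.comp_apply, PowerSeries.coeff_C_mul, PowerSeries.coeff_mk, hc]
  obtain ⟨i, hi⟩ := hex
  have hgi : PowerSeries.coeff i Q ≠ 0 := fun h => hi (h ▸ dvd_zero _)
  obtain ⟨m₀, hm₀⟩ := C_pow_dvd_of_mk_mem_span 𝒪 p hmax hgi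
  refine ⟨m₀, fun m hm => ?_⟩
  set π := Ideal.Quotient.mk (Ideal.span {combSeries 𝒪 p m}) with hπ
  set ϖ := π PowerSeries.X with hϖ
  set d := (combPoly p m).natDegree with hd
  rintro ⟨s, u, hu, hshape⟩
  obtain ⟨w, hw⟩ := exists_natCast_p_eq_varpi_pow_mul 𝒪 p m
  have hπp : π (PowerSeries.C (p : 𝒪)) = ϖ ^ d * ↑w := by
    rw [← hw]; simp [hπ]
  -- facts about `red S = map π S`: a unit coefficient, a non-unit constant coefficient
  obtain ⟨σ, hσs, hσ, hker⟩ := exists_levelRing_to_residue 𝒪 p m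
  have hσϖ : σ ϖ = 0 := by rw [← RingHom.mem_ker, hker]; exact Ideal.mem_span_singleton_self _
  have hunitcoeff : ∃ n, IsUnit (PowerSeries.coeff n (PowerSeries.map π S)) := by
    by_contra hall
    push Not at hall
    apply hθS
    ext n
    rw [map_zero, hθ, ← hσ, PowerSeries.map_comp, RingHom.comp_apply, PowerSeries.coeff_map]
    have hn : PowerSeries.coeff n (PowerSeries.map π S) ∈ Ideal.span {ϖ} := by
      by_contra hnot
      exact hall n (levelRing_isUnit_of_not_mem 𝒪 p hmax m hnot)
    rw [← hker] at hn
    exact (RingHom.mem_ker).mp hn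
  have hconst : PowerSeries.coeff 0 (PowerSeries.map π S) ∈ Ideal.span {ϖ} := by
    rw [PowerSeries.coeff_map, PowerSeries.coeff_zero_eq_constantCoeff_apply]
    have h0 : PowerSeries.constantCoeff (PowerSeries.constantCoeff S) ∈ Ideal.span {(p : 𝒪)} := by
      rw [← hmax, IsLocalRing.mem_maximalIdeal, mem_nonunits_iff]
      intro h
      exact hSu (PowerSeries.isUnit_iff_constantCoeff.mpr (PowerSeries.isUnit_iff_constantCoeff.mpr h))
    obtain ⟨c, hc⟩ := Ideal.mem_span_singleton.mp h0
    have hsplit : PowerSeries.constantCoeff S =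
        PowerSeries.X * (PowerSeries.mk fun q => PowerSeries.coeff (q + 1) (PowerSeries.constantCoeff S)) +
          PowerSeries.C (p : 𝒪) * PowerSeries.C c := by
      conv_lhs => rw [PowerSeries.eq_X_mul_shift_add_const (PowerSeries.constantCoeff S), hc, map_mul]
    rw [hsplit, map_add, map_mul, map_mul, hπp]
    refine Ideal.add_mem _ (Ideal.mul_mem_right _ _ (Ideal.mem_span_singleton_self _)) ?_
    refine Ideal.mul_mem_right _ _ (Ideal.mul_mem_right _ _ ?_)
    exact Ideal.pow_mem_of_mem _ (Ideal.mem_span_singleton_self _) _ (natDegree_combPoly_pos p m)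
  -- `red S` is never `ϖ^t · unit`
  have hSshape : ¬ ∃ (t : ℕ) (u' : PowerSeries (LevelRing 𝒪 p m)), IsUnit u' ∧
      PowerSeries.map π S = PowerSeries.C (ϖ ^ t) * u' := by
    rintro ⟨t, u', hu', hS'⟩
    rcases Nat.eq_zero_or_pos t with rfl | ht
    · rw [pow_zero, map_one, one_mul] at hS'
      have h1 : IsUnit (PowerSeries.coeff 0 (PowerSeries.map π S)) := by
        rw [hS', PowerSeries.coeff_zero_eq_constantCoeff_apply]
        exact PowerSeries.isUnit_constantCoeff _ hu'
      obtain ⟨y, hy⟩ := Ideal.mem_span_singleton'.mp hconst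
      exact varpi_not_isUnit 𝒪 p m hpu (isUnit_of_mul_isUnit_right (hy ▸ h1))
    · obtain ⟨n, hn⟩ := hunitcoeff
      rw [hS', PowerSeries.coeff_C_mul] at hn
      exact varpi_not_isUnit 𝒪 p m hpu
        (isUnit_of_dvd_unit (dvd_mul_of_dvd_left (dvd_pow_self _ ht.ne') _) hn)
  -- the reduction of `Q`
  have hredQ : PowerSeries.map π Q =
      PowerSeries.C (ϖ ^ d * ↑w) * PowerSeries.map π (a + b₁ * S) +
        PowerSeries.C ϖ * (PowerSeries.map π S * PowerSeries.map π b₂) := by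
    conv_lhs => rw [hQeq]
    rw [map_add, map_mul, map_mul, const, RingHom.comp_apply, PowerSeries.map_C, hπp, T₂, PowerSeries.map_C,
      ← hϖ]
    simp only [map_mul]
  rcases le_or_gt d s with hds | hsd
  · -- `s ≥ d`: the `i`-th coefficient of `Q` reduces into `(p)`, so `p ∣ [T₁^i] Q`
    apply hi
    simpa using hm₀ m hm 1 (by
      rw [pow_one]
      have := congrArg (PowerSeries.coeff i) hshape
      rw [PowerSeries.coeff_map, PowerSeries.coeff_C_mul] at this
      rw [this]
      have hϖs : ϖ ^ s ∈ Ideal.span {(p : LevelRing 𝒪 p m)} := by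
        have : (p : LevelRing 𝒪 p m) * ↑w⁻¹ = ϖ ^ d := by rw [hw, mul_assoc, Units.mul_inv, mul_one]
        rw [← Nat.add_sub_cancel' hds, pow_add, ← this, mul_assoc]
        exact Ideal.mul_mem_right _ _ (Ideal.mem_span_singleton_self _)
      exact Ideal.mul_mem_right _ _ hϖs)
  · -- `s < d`
    rcases Nat.eq_zero_or_pos s with rfl | hs
    · -- `s = 0`: `red Q` is a unit but every term of `red Q` is divisible by `ϖ`
      rw [pow_zero, map_one, one_mul] at hshape
      have h1 : IsUnit (PowerSeries.constantCoeff (PowerSeries.map π Q)) := PowerSeries.isUnit_constantCoeff _ (hshape ▸ hu)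
      rw [hredQ] at h1
      apply varpi_not_isUnit 𝒪 p m hpu
      refine isUnit_of_dvd_unit ?_ h1
      simp only [map_add, map_mul, PowerSeries.constantCoeff_C]
      exact dvd_add (dvd_mul_of_dvd_left (dvd_mul_of_dvd_left (dvd_pow_self _ (natDegree_combPoly_pos p m).ne') _) _)
        (dvd_mul_right _ _)
    · -- `1 ≤ s < d`: cancel one `ϖ` and descend on `red S · red b₂ = ϖ^{s-1} · (unit)`
      have hkey : PowerSeries.C ϖ * (PowerSeries.map π S * PowerSeries.map π b₂ -
          PowerSeries.C (ϖ ^ (s - 1)) * (u - PowerSeries.C (ϖ ^ (d - s) * ↑w) * PowerSeries.map π (a + b₁ * S))) = 0 := by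
        have e1 : PowerSeries.C ϖ * PowerSeries.C (ϖ ^ (s - 1)) = PowerSeries.C (ϖ ^ s) := by
          rw [← map_mul, ← pow_succ', Nat.sub_add_cancel hs]
        have e2 : PowerSeries.C (ϖ ^ s) * PowerSeries.C (ϖ ^ (d - s) * ↑w) = PowerSeries.C (ϖ ^ d * ↑w) := by
          rw [← map_mul, ← mul_assoc, ← pow_add, Nat.add_sub_cancel' hsd.le]
        have : PowerSeries.C ϖ * (PowerSeries.map π S * PowerSeries.map π b₂) =
            PowerSeries.C (ϖ ^ s) * u - PowerSeries.C (ϖ ^ d * ↑w) * PowerSeries.map π (a + b₁ * S) := by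
          rw [← hshape, hredQ]; ring
        rw [mul_sub, this, ← mul_assoc, e1, mul_sub, ← mul_assoc (PowerSeries.C (ϖ ^ s)), e2]; ring
      have hdesc := C_mul_eq_zero_imp (fun z hz => varpi_mul_eq_zero_imp 𝒪 p m hp0 hz) hkey
      rw [sub_eq_zero] at hdesc
      have hunit' : IsUnit (u - PowerSeries.C (ϖ ^ (d - s) * ↑w) * PowerSeries.map π (a + b₁ * S)) := by
        rw [PowerSeries.isUnit_iff_constantCoeff, map_sub, map_mul, PowerSeries.constantCoeff_C]
        have hu0 : IsUnit (PowerSeries.constantCoeff u) := PowerSeries.isUnit_constantCoeff u hu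
        -- `unit − (multiple of ϖ)` is a unit in the local ring `𝒪_m`
        apply levelRing_isUnit_of_not_mem 𝒪 p hmax m
        intro hmem
        have : PowerSeries.constantCoeff u ∈ Ideal.span {ϖ} := by
          have h3 : ϖ ^ (d - s) * ↑w * PowerSeries.constantCoeff (PowerSeries.map π (a + b₁ * S)) ∈ Ideal.span {ϖ} :=
            Ideal.mul_mem_right _ _ (Ideal.mul_mem_right _ _
              (Ideal.pow_mem_of_mem _ (Ideal.mem_span_singleton_self _) _ (Nat.sub_pos_of_lt hsd)))
          have := Ideal.add_mem _ hmem h3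
          rwa [sub_add_cancel] at this
        obtain ⟨y, hy⟩ := Ideal.mem_span_singleton'.mp this
        exact varpi_not_isUnit 𝒪 p m hpu (isUnit_of_mul_isUnit_right (hy ▸ hu0))
      exact hSshape (exists_eq_C_pow_mul_unit_of_mul_eq_unit (varpi_prime 𝒪 p m hp0)
        (fun z hz => varpi_mul_eq_zero_imp 𝒪 p m hp0 hz) (s - 1) _ _ _ hunit' hdesc)

end WeakVisibility


end Summit.BirchSwinnertonDyer.BirchSwinnertonDyer.Theorems.UniversalToricDescentThinComb

end
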